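import Mathlib.Algebra.BigOperators.Fin
import Mathlib.Algebra.Order.BigOperators.Group.Finset
import Mathlib.Algebra.Order.Group.Indicator
import Mathlib.Data.Finset.Max
import Mathlib.Data.Fintype.Sigma
import Mathlib.Data.Real.Basic
import Mathlib.Tactic.Linarith
import Mathlib.Tactic.NormNum
import Mathlib.Tactic.Ring
import HarnessLib

/-!
# The cut-cone representation of `ℓ₁`-metrics on finite sets

Family `pnp`, layer `Literature/Geometry/MetricEmbeddings`. The first step of every lower bound for
`L₁`-distortion (and of the Linial–London–Rabinovich / Aumann–Rabani identification of the
sparsest-cut integrality gap with `c₁`): an `ℓ₁`-valued map on a finite set induces a nonnegative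
combination of CUT SEMIMETRICS. Source: J. Cheeger, B. Kleiner, A. Naor, arXiv:0910.2026 §2
(p. 7): "The approach of [CK10] starts out with the cut-cone representation of `L₁` metrics
(see [DL97, CK10]), which asserts that for every `f : ℍ → L₁` we can write
`‖f(x) − f(y)‖_{L₁} = ∫_{2^ℍ} |χ_E(x) − χ_E(y)| dΣ_f(E)` for all `x, y`" — here in the finite,
finite-dimensional case, where the cut measure `Σ_f` is a finite sum (M. Deza, M. Laurent,
*Geometry of Cuts and Metrics*, Ch. 4, "the cut cone and `ℓ₁`-metrics").

PROVED here (no named facts):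

* `exists_threshold_decomposition`: for a finite set `T ⊂ ℝ` there are finitely many thresholds
  `θ_i` with weights `w_i ≥ 0` (the gaps between consecutive elements of `T`) such that
  `|a − b| = Σ_i w_i |𝟙(θ_i < a) − 𝟙(θ_i < b)|` for all `a, b ∈ T` (one-dimensional layer cake;
  proved by induction on the maximum of `T`);
* `exists_cut_decomposition`: for a finite `S ⊆ α` and `f : α → ℓ₁^N = (Fin N → ℝ)` there are
  finitely many cuts `E_i ⊆ α` with weights `w_i ≥ 0` such that
  `Σ_k |f g k − f h k| = Σ_i w_i |𝟙_{E_i}(g) − 𝟙_{E_i}(h)|` for all `g, h ∈ S`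
  (the cuts are the superlevel sets `{x | θ < f x k}`);
* `exists_cut_sparsity_le`: for nonnegative capacities and demands on pairs of `S`, some cut with
  positive demand across it is at least as sparse as the `ℓ₁`-metric of `f` (the easy direction of
  the Linial–London–Rabinovich / Aumann–Rabani identification "sparsest-cut gap = `c₁`").

Not here: the converse (every cut semimetric is an `ℓ₁`-metric, trivial), the continuous cut
measure `Σ_f` of [CK10], and the LP-duality (hard) direction of Linial–London–Rabinovich.

## References

* [CheegerKleinerNaor2011] J. Cheeger, B. Kleiner, A. Naor, Acta Math. 207 (2011), §2
  (arXiv:0910.2026 p. 7), citing [DL97] = [DezaLaurent1997] M. Deza, M. Laurent, *Geometry of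
  Cuts and Metrics*, Springer 1997, Ch. 4.
-/

noncomputable section

open Finset

namespace Literature.Geometry.MetricEmbeddings

/-- **One-dimensional layer-cake / threshold decomposition.** For a finite set `T` of reals
there are thresholds `θ_i` (all below `max T`) and weights `w_i ≥ 0` with
`|a − b| = Σ_i w_i · |𝟙(θ_i < a) − 𝟙(θ_i < b)|` for all `a, b ∈ T` (take the elements of `T` but
the largest as thresholds, weighted by the gap to the next element).
[cite: CheegerKleinerNaor2011, §2] -/
theorem exists_threshold_decomposition (T : Finset ℝ) :
    ∃ (m : ℕ) (w θ : Fin m → ℝ), (∀ i, 0 ≤ w i) ∧ (∀ i, ∃ a ∈ T, θ i < a) ∧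
      ∀ a ∈ T, ∀ b ∈ T,
        |a - b| = ∑ i, w i * |(Set.Ioi (θ i)).indicator 1 a - (Set.Ioi (θ i)).indicator 1 b| := by
  induction T using Finset.induction_on_max with
  | empty =>
    exact ⟨0, Fin.elim0, Fin.elim0, fun i => i.elim0, fun i => i.elim0, fun a ha => by simp at ha⟩
  | insert c s hc ih =>
    obtain ⟨m, w, θ, hw, hθ, hrepr⟩ := ih
    rcases s.eq_empty_or_nonempty with rfl | hs
    · refine ⟨0, Fin.elim0, Fin.elim0, fun i => i.elim0, fun i => i.elim0, ?_⟩
      intro a ha b hb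
      simp only [insert_empty_eq, mem_singleton] at ha hb
      subst ha hb
      simp
    · -- thresholds: the old ones and `u = max s`, the latter with weight `c - u`
      set u := s.max' hs with hu
      have hus : u ∈ s := s.max'_mem hs
      have huc : u < c := hc u hus
      have hle : ∀ x ∈ s, x ≤ u := fun x hx => s.le_max' x hx
      have hθu : ∀ i, θ i < u := fun i => by
        obtain ⟨a, ha, hlt⟩ := hθ i
        exact hlt.trans_le (hle a ha)
      -- indicator evaluations
      have ind_u_c : (Set.Ioi u).indicator (1 : ℝ → ℝ) c = 1 :=
        by rw [Set.indicator_of_mem (Set.mem_Ioi.mpr huc), Pi.one_apply]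
      have ind_u_s : ∀ x ∈ s, (Set.Ioi u).indicator (1 : ℝ → ℝ) x = 0 := fun x hx =>
        Set.indicator_of_notMem (fun h : x ∈ Set.Ioi u => (not_lt.mpr (hle x hx)) h) _
      have ind_θ_c : ∀ i, (Set.Ioi (θ i)).indicator (1 : ℝ → ℝ) c =
          (Set.Ioi (θ i)).indicator (1 : ℝ → ℝ) u := fun i => by
        rw [Set.indicator_of_mem (Set.mem_Ioi.mpr ((hθu i).trans huc)),
          Set.indicator_of_mem (Set.mem_Ioi.mpr (hθu i)), Pi.one_apply, Pi.one_apply]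
      refine ⟨m + 1, Fin.cons (c - u) w, Fin.cons u θ, ?_, ?_, ?_⟩
      · refine Fin.cases ?_ ?_
        · simpa using huc.le
        · intro i
          simpa using hw i
      · refine Fin.cases ?_ ?_
        · exact ⟨c, mem_insert_self c s, by simpa using huc⟩
        · intro i
          obtain ⟨a, ha, hlt⟩ := hθ i
          exact ⟨a, mem_insert_of_mem ha, by simpa using hlt⟩
      · intro a ha b hb
        rw [Fin.sum_univ_succ]
        simp only [Fin.cons_zero, Fin.cons_succ]
        rw [mem_insert] at ha hb
        rcases ha with ha | ha <;> rcases hb with hb | hb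
        · -- `a = b = c`
          rw [ha, hb]
          simp
        · -- `a = c`, `b ∈ s`: `|c - b| = (c - u) + |u - b|`
          have e1 : |c - b| = c - b := abs_of_nonneg (by linarith [hle b hb])
          have e2 : |u - b| = u - b := abs_of_nonneg (by linarith [hle b hb])
          rw [ha, ind_u_c, ind_u_s b hb]
          simp only [ind_θ_c]
          rw [← hrepr u hus b hb, e1, e2]
          norm_num
        · -- `a ∈ s`, `b = c`
          have e1 : |a - c| = c - a := by
            rw [abs_of_nonpos (by linarith [hle a ha])]; ring
          have e2 : |a - u| = u - a := by
            rw [abs_of_nonpos (by linarith [hle a ha])]; ring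
          rw [hb, ind_u_c, ind_u_s a ha]
          simp only [ind_θ_c]
          rw [← hrepr a ha u hus, e1, e2]
          norm_num
        · -- `a, b ∈ s`
          rw [ind_u_s a ha, ind_u_s b hb, ← hrepr a ha b hb]
          simp

/-- **Cut-cone representation of `ℓ₁`-metrics on finite sets.** For a finite `S ⊆ α` and
`f : α → ℓ₁^N`, the `ℓ₁`-distances between points of `S` are a nonnegative combination of cut
semimetrics: there are finitely many cuts `E_i ⊆ α` and weights `w_i ≥ 0` with
`Σ_k |f g k − f h k| = Σ_i w_i |𝟙_{E_i}(g) − 𝟙_{E_i}(h)|` for all `g, h ∈ S` (the cuts are the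
superlevel sets `{x | θ < f x k}` of the coordinates). Consequently any ratio of two nonnegative
linear functionals of the distance (capacity/demand) is bounded by its extreme values on cuts —
the mechanism behind both `L₁`-distortion lower bounds and sparsest-cut integrality gaps.
[cite: CheegerKleinerNaor2011, §2] -/
theorem exists_cut_decomposition {α : Type*} (S : Finset α) {N : ℕ} (f : α → Fin N → ℝ) :
    ∃ (ι : Type) (_ : Fintype ι) (w : ι → ℝ) (E : ι → Set α), (∀ i, 0 ≤ w i) ∧
      ∀ g ∈ S, ∀ h ∈ S,
        ∑ k, |f g k - f h k| = ∑ i, w i * |(E i).indicator 1 g - (E i).indicator 1 h| := by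
  classical
  choose m w θ hw _hθ hrepr using
    fun k : Fin N => exists_threshold_decomposition (S.image fun s => f s k)
  refine ⟨(Σ k : Fin N, Fin (m k)), inferInstance, fun p => w p.1 p.2,
    fun p => {x | θ p.1 p.2 < f x p.1}, fun p => hw p.1 p.2, fun g hg h hh => ?_⟩
  rw [← Finset.univ_sigma_univ, Finset.sum_sigma]
  refine Finset.sum_congr rfl fun k _ => ?_
  rw [hrepr k (f g k) (mem_image_of_mem (fun s => f s k) hg) (f h k)
    (mem_image_of_mem (fun s => f s k) hh)]
  refine Finset.sum_congr rfl fun i _ => ?_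
  by_cases hg' : θ k i < f g k <;> by_cases hh' : θ k i < f h k <;>
    simp [hg', hh']

/-- **Some cut is at least as sparse as the `ℓ₁`-metric (Linial–London–Rabinovich /
Aumann–Rabani, easy direction).** For nonnegative capacities `cap` and demands `dem` on pairs of a
finite `S` and `f : α → ℓ₁^N` with positive total demand-length `Σ dem(g,h)‖f g − f h‖₁`, there
is a cut `E` with positive demand across it whose sparsity does not exceed that of the metric:
`cap(δE) · Σ dem‖f g − f h‖₁ ≤ (Σ cap‖f g − f h‖₁) · dem(δE)`. (A ratio of two nonnegative linear
functionals over the cut cone attains its minimum on an extreme ray; with `exists_cut_decomposition`.)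
Consequently a distortion-`D` embedding of a metric into `ℓ₁` produces a cut of sparsity at most
`D` times the metric (LP) relaxation value. [cite: CheegerKleinerNaor2011, §2] -/
theorem exists_cut_sparsity_le {α : Type*} (S : Finset α) {N : ℕ} (f : α → Fin N → ℝ)
    (cap dem : α → α → ℝ) (hcap : ∀ g h, 0 ≤ cap g h) (hdem : ∀ g h, 0 ≤ dem g h)
    (hpos : 0 < ∑ g ∈ S, ∑ h ∈ S, dem g h * ∑ k, |f g k - f h k|) :
    ∃ E : Set α, 0 < ∑ g ∈ S, ∑ h ∈ S, dem g h * |E.indicator 1 g - E.indicator 1 h| ∧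
      (∑ g ∈ S, ∑ h ∈ S, cap g h * |E.indicator 1 g - E.indicator 1 h|) *
          (∑ g ∈ S, ∑ h ∈ S, dem g h * ∑ k, |f g k - f h k|) ≤
        (∑ g ∈ S, ∑ h ∈ S, cap g h * ∑ k, |f g k - f h k|) *
          (∑ g ∈ S, ∑ h ∈ S, dem g h * |E.indicator 1 g - E.indicator 1 h|) := by
  obtain ⟨ι, _, w, E, hw, hrepr⟩ := exists_cut_decomposition S f
  -- capacity and demand across the cut `E i`
  set A : ι → ℝ := fun i => ∑ g ∈ S, ∑ h ∈ S, cap g h * |(E i).indicator 1 g - (E i).indicator 1 h|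
    with hAdef
  set B : ι → ℝ := fun i => ∑ g ∈ S, ∑ h ∈ S, dem g h * |(E i).indicator 1 g - (E i).indicator 1 h|
    with hBdef
  -- linearity: the two functionals of the metric are `Σ w_i A_i` and `Σ w_i B_i`
  have hlin : ∀ c : α → α → ℝ,
      ∑ g ∈ S, ∑ h ∈ S, c g h * ∑ k, |f g k - f h k| =
        ∑ i, w i * ∑ g ∈ S, ∑ h ∈ S, c g h * |(E i).indicator 1 g - (E i).indicator 1 h| := by
    intro c
    calc ∑ g ∈ S, ∑ h ∈ S, c g h * ∑ k, |f g k - f h k|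
        = ∑ g ∈ S, ∑ h ∈ S, ∑ i,
            w i * (c g h * |(E i).indicator 1 g - (E i).indicator 1 h|) := by
          refine Finset.sum_congr rfl fun g hg => Finset.sum_congr rfl fun h hh => ?_
          rw [hrepr g hg h hh, Finset.mul_sum]
          refine Finset.sum_congr rfl fun i _ => ?_
          ring
      _ = ∑ g ∈ S, ∑ i, ∑ h ∈ S,
            w i * (c g h * |(E i).indicator 1 g - (E i).indicator 1 h|) := by
          refine Finset.sum_congr rfl fun g _ => ?_
          exact Finset.sum_comm
      _ = ∑ i, ∑ g ∈ S, ∑ h ∈ S,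
            w i * (c g h * |(E i).indicator 1 g - (E i).indicator 1 h|) := Finset.sum_comm
      _ = ∑ i, w i * ∑ g ∈ S, ∑ h ∈ S, c g h * |(E i).indicator 1 g - (E i).indicator 1 h| := by
          refine Finset.sum_congr rfl fun i _ => ?_
          rw [Finset.mul_sum]
          refine Finset.sum_congr rfl fun g _ => ?_
          rw [Finset.mul_sum]
  have hA : ∑ g ∈ S, ∑ h ∈ S, cap g h * ∑ k, |f g k - f h k| = ∑ i, w i * A i := hlin cap
  have hB : ∑ g ∈ S, ∑ h ∈ S, dem g h * ∑ k, |f g k - f h k| = ∑ i, w i * B i := hlin dem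
  have hA0 : ∀ i, 0 ≤ A i := fun i =>
    Finset.sum_nonneg fun g _ => Finset.sum_nonneg fun h _ => mul_nonneg (hcap g h) (abs_nonneg _)
  have hB0 : ∀ i, 0 ≤ B i := fun i =>
    Finset.sum_nonneg fun g _ => Finset.sum_nonneg fun h _ => mul_nonneg (hdem g h) (abs_nonneg _)
  rw [hA, hB]
  rw [hB] at hpos
  set P := ∑ i, w i * A i with hP
  set Q := ∑ i, w i * B i with hQ
  have hP0 : 0 ≤ P := Finset.sum_nonneg fun i _ => mul_nonneg (hw i) (hA0 i)
  -- some cut `E i₀` carries positive weighted demand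
  obtain ⟨i₀, hi₀⟩ : ∃ i, 0 < w i * B i := by
    by_contra hcon
    have : Q ≤ 0 := Finset.sum_nonpos fun i _ => not_lt.mp fun h => hcon ⟨i, h⟩
    exact absurd hpos (not_lt.mpr this)
  by_contra hcon
  -- every cut with positive demand is strictly sparser-than-claimed: `P · B i < A i · Q`
  have hlt : ∀ i, 0 < B i → P * B i < A i * Q := by
    intro i hi
    by_contra hle
    exact hcon ⟨E i, hi, not_lt.mp hle⟩
  -- weight by `w i ≥ 0` and sum: `P Q < Q P`
  have hle : ∀ i ∈ (Finset.univ : Finset ι), P * (w i * B i) ≤ Q * (w i * A i) := by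
    intro i _
    rcases (hB0 i).eq_or_lt with h0 | hBi
    · rw [← h0, mul_zero, mul_zero]
      exact mul_nonneg (hpos.le) (mul_nonneg (hw i) (hA0 i))
    · have := hlt i hBi
      nlinarith [hw i]
  have hstrict : ∃ i ∈ (Finset.univ : Finset ι), P * (w i * B i) < Q * (w i * A i) := by
    refine ⟨i₀, Finset.mem_univ _, ?_⟩
    have hw0 : 0 < w i₀ := by
      rcases (hw i₀).eq_or_lt with h0 | h
      · rw [← h0, zero_mul] at hi₀; exact absurd hi₀ (lt_irrefl 0)
      · exact h
    have hB0' : 0 < B i₀ := by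
      rcases (hB0 i₀).eq_or_lt with h0 | h
      · rw [← h0, mul_zero] at hi₀; exact absurd hi₀ (lt_irrefl 0)
      · exact h
    have := hlt i₀ hB0'
    nlinarith
  have key := Finset.sum_lt_sum hle hstrict
  rw [← Finset.mul_sum, ← Finset.mul_sum] at key
  -- key : P * Q < Q * P
  linarith [mul_comm P Q]

end Literature.Geometry.MetricEmbeddings

end
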